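import Literature.NumberTheory.EllipticCurves.Rank1Residual.GVParityTwistProofs
import Literature.NumberTheory.GaloisRepresentations.IntegralGaloisActionProofs
import Literature.NumberTheory.GaloisRepresentations.AbsGaloisOuterConj
import Literature.NumberTheory.EllipticCurves.SemistableModPImageAbelianProofs
import HarnessLib

/-!
# Rational lines of `E[p]`: transport along an equivariant map, and ramification at every prime above `p`

HONEST FRAMING (cell `b2b-bsdres`, home `run/shared/lean/b2b/bsd-rank1-residual/`): the cell deletes
COMBINATION-SHAPED residual classes of the rank-`≤ 1` BSD formula from PUBLISHED theorems only and
types the rest; this is not "finishing BSD". `Proofs`-style file (theorems only, no definition, no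
named fact), prover x1a gen 2; first half of the isogeny-invariance of the Greenberg–Vatsal parity
type `GVPar` (`Rank1Residual/Predicates.lean`), completed in `GVParityIsogenyProofs.lean`.

* `line_eq_or_inf_eq_bot`, `eq_zero_of_add_self_eq_zero` — two subgroups of order `p` of `E[p]`
  are equal or meet trivially; `E[p]` has no `2`-torsion for odd `p`.
* `isRationalLine_map`, `lineUnramifiedAt_map`, `not_lineUnramifiedAt_map`, `lineEven_map`,
  `lineOdd_map`, `gvPar_of_map_injOn` — a rational line `Φ ≤ E[p]`, its (un)ramification at `p` and
  its parity are transported along any `Γ_ℚ`-equivariant homomorphism `g : E[p] → E'[p]` injective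
  on `Φ`; hence so is the Greenberg–Vatsal condition "(ramified ∧ even) ∨ (unramified ∧ odd)".
* `exists_inertia_smul_ne_of_not_lineUnramifiedAt` — a rational line moved by the inertia group of
  ONE prime of `\bar ℤ` above `p` is moved by the inertia group of EVERY prime above `p` (the primes
  above `p` are `Γ_ℚ`-conjugate, `HeightOneSpectrum.exists_smul_eq_of_mem_primesAbove_holds`, and
  `I_{g𝔓} = g I_𝔓 g⁻¹`, `Ideal.conj_mem_inertia_smul_iff`).

## References
* R. Greenberg, V. Vatsal, Invent. Math. 142 (2000), §1 (the parity condition). [GreenbergVatsal2000]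
* J. Neukirch, *Algebraic Number Theory*, I §9 (9.1), (9.4). [NeukirchANT1999]
* J. H. Silverman, *AEC*, III.6.4, III.7. [SilvermanAEC2009]
-/

set_option autoImplicit false

noncomputable section

open scoped Classical

open WeierstrassCurve Literature.NumberTheory.EllipticCurves Literature.NumberTheory.GaloisRepresentations
  Field IsDedekindDomain NumberField

namespace Literature.NumberTheory.EllipticCurves.Rank1Residual

variable {W W' : WeierstrassCurve ℚ} [W.IsElliptic] [W'.IsElliptic] {p : ℕ} [Fact p.Prime]

/-! ### Lines in `E[p]` -/

omit [W.IsElliptic] in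
/-- Two subgroups of order `p` of `E[p]` are equal or meet trivially. [folklore] -/
theorem line_eq_or_inf_eq_bot {Φ L : AddSubgroup (geomTorsion W (p : ℤ))}
    (hΦ : Nat.card Φ = p) (hL : Nat.card L = p) : Φ = L ∨ Φ ⊓ L = ⊥ := by
  have hp : p.Prime := Fact.out
  by_cases h : Φ ⊓ L = ⊥
  · exact Or.inr h
  · left
    -- `Φ ⊓ L` is a nontrivial subgroup of the group `Φ` of prime order, hence all of `Φ`
    haveI : Finite Φ := Nat.finite_of_card_ne_zero (by rw [hΦ]; exact hp.ne_zero)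
    haveI : Finite L := Nat.finite_of_card_ne_zero (by rw [hL]; exact hp.ne_zero)
    have hdvd : Nat.card ↥(Φ ⊓ L) ∣ p := by
      have h' : Nat.card ↥(Φ ⊓ L) ∣ Nat.card Φ := AddSubgroup.card_dvd_of_le inf_le_left
      rwa [hΦ] at h'
    rcases (Nat.dvd_prime hp).mp hdvd with h1 | hcard
    · exact absurd (AddSubgroup.card_eq_one.mp h1) h
    · have hle1 : Φ ⊓ L ≤ Φ := inf_le_left
      have hle2 : Φ ⊓ L ≤ L := inf_le_right
      have h1 : Φ ⊓ L = Φ :=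
        AddSubgroup.eq_of_le_of_card_ge hle1 (by rw [hΦ, hcard])
      have h2 : Φ ⊓ L = L :=
        AddSubgroup.eq_of_le_of_card_ge hle2 (by rw [hL, hcard])
      rw [← h1, h2]

omit [W.IsElliptic] in
/-- `E[p]` has no `2`-torsion for odd `p`: `P + P = 0 ⇒ P = 0`. [folklore] -/
theorem eq_zero_of_add_self_eq_zero (hp2 : p ≠ 2) {P : geomTorsion W (p : ℤ)}
    (h : P + P = 0) : P = 0 := by
  have hp : p.Prime := Fact.out
  have hpP : (p : ℤ) • P = 0 := by
    apply Subtype.ext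
    have h0 : (p : ℤ) • (P : geomPoints W) = 0 := (Submodule.mem_torsionBy_iff (p : ℤ) _).mp P.2
    simp
  have h2 : (2 : ℤ) • P = 0 := by rw [two_zsmul]; exact h
  -- `gcd(2, p) = 1`
  have hodd : Odd p := hp.odd_of_ne_two hp2
  obtain ⟨k, hk⟩ := hodd
  have : P = (p : ℤ) • P - (k : ℤ) • ((2 : ℤ) • P) := by
    rw [smul_smul, ← sub_smul]
    have : ((p : ℤ) - k * 2) = 1 := by push_cast [hk]; ring
    rw [this, one_smul]
  rw [this, hpP, h2, smul_zero, sub_zero]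

/-! ### Transfer of a rational line along an equivariant homomorphism `E[p] → E'[p]` injective on it -/

section Transfer

variable (g : geomTorsion W (p : ℤ) →+ geomTorsion W' (p : ℤ))
  (hg : ∀ (σ : absoluteGaloisGroup ℚ) (P : geomTorsion W (p : ℤ)), g (σ • P) = σ • g P)

omit [W.IsElliptic] [W'.IsElliptic] in
include hg in
/-- The image of a rational line under a `Γ_ℚ`-equivariant homomorphism `E[p] → E'[p]` injective on
the line is a rational line. [folklore] -/
theorem isRationalLine_map {Φ : AddSubgroup (geomTorsion W (p : ℤ))} (hΦ : IsRationalLine W p Φ)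
    (hinj : ∀ P ∈ Φ, g P = 0 → P = 0) : IsRationalLine W' p (Φ.map g) := by
  refine ⟨?_, ?_⟩
  · -- order `p`: `g` restricted to `Φ` is injective
    have hinj' : Function.Injective (g.comp Φ.subtype) := by
      rw [injective_iff_map_eq_zero]
      intro a ha
      have ha' : (a : geomTorsion W (p : ℤ)) = 0 := hinj a a.2 ha
      exact Subtype.ext ha'
    have hrange : (g.comp Φ.subtype).range = Φ.map g := by
      rw [AddMonoidHom.range_comp, AddSubgroup.range_subtype]
    rw [← hrange]
    have hc : Nat.card ↥(g.comp Φ.subtype).range = Nat.card Φ :=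
      Nat.card_congr (AddMonoidHom.ofInjective hinj').toEquiv.symm
    rw [hc, hΦ.1]
  · -- `Γ_ℚ`-stable
    intro σ Q hQ
    obtain ⟨P, hP, rfl⟩ := AddSubgroup.mem_map.mp hQ
    exact AddSubgroup.mem_map.mpr ⟨σ • P, hΦ.2 σ P hP, hg σ P⟩

omit [W.IsElliptic] [W'.IsElliptic] in
include hg in
/-- Unramifiedness at `p` of a line passes to its image. [folklore] -/
theorem lineUnramifiedAt_map {Φ : AddSubgroup (geomTorsion W (p : ℤ))}
    (h : LineUnramifiedAt W p Φ) : LineUnramifiedAt W' p (Φ.map g) := by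
  intro v hv 𝔓 h𝔓 σ hσ Q hQ
  obtain ⟨P, hP, rfl⟩ := AddSubgroup.mem_map.mp hQ
  rw [← hg, h v hv 𝔓 h𝔓 σ hσ P hP]

omit [W.IsElliptic] [W'.IsElliptic] in
include hg in
/-- Ramification at `p` of a line passes to its image when the map is injective on the line. [folklore] -/
theorem not_lineUnramifiedAt_map {Φ : AddSubgroup (geomTorsion W (p : ℤ))}
    (hinj : ∀ P ∈ Φ, g P = 0 → P = 0) (hΦ : IsRationalLine W p Φ)
    (h : ¬ LineUnramifiedAt W p Φ) : ¬ LineUnramifiedAt W' p (Φ.map g) := by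
  intro h'
  apply h
  intro v hv 𝔓 h𝔓 σ hσ P hP
  have h1 : σ • g P = g P := h' v hv 𝔓 h𝔓 σ hσ (g P) (AddSubgroup.mem_map.mpr ⟨P, hP, rfl⟩)
  rw [← hg] at h1
  -- `g (σ • P - P) = 0` with `σ • P - P ∈ Φ`
  have h2 : g (σ • P - P) = 0 := by rw [map_sub, h1, sub_self]
  have h3 : σ • P - P = 0 := hinj _ (Φ.sub_mem (hΦ.2 σ P hP) hP) h2
  exact sub_eq_zero.mp h3

omit [W.IsElliptic] [W'.IsElliptic] in
include hg in
/-- Evenness of a line passes to its image. [folklore] -/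
theorem lineEven_map {Φ : AddSubgroup (geomTorsion W (p : ℤ))}
    (h : LineEven W p Φ) : LineEven W' p (Φ.map g) := by
  intro c hc Q hQ
  obtain ⟨P, hP, rfl⟩ := AddSubgroup.mem_map.mp hQ
  rw [← hg, h c hc P hP]

omit [W.IsElliptic] [W'.IsElliptic] in
include hg in
/-- Oddness of a line passes to its image. [folklore] -/
theorem lineOdd_map {Φ : AddSubgroup (geomTorsion W (p : ℤ))}
    (h : LineOdd W p Φ) : LineOdd W' p (Φ.map g) := by
  intro c hc Q hQ
  obtain ⟨P, hP, rfl⟩ := AddSubgroup.mem_map.mp hQ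
  rw [← hg, h c hc P hP, map_neg]

omit [W.IsElliptic] [W'.IsElliptic] in
include hg in
/-- **Transfer of the Greenberg–Vatsal condition along a map injective on the line**: if the
rational line `Φ ≤ E[p]` is (ramified ∧ even) ∨ (unramified ∧ odd), so is its image under a
`Γ_ℚ`-equivariant `g : E[p] → E'[p]` injective on `Φ`, whence `GVPar W' p`. [folklore] -/
theorem gvPar_of_map_injOn {Φ : AddSubgroup (geomTorsion W (p : ℤ))} (hΦ : IsRationalLine W p Φ)
    (hinj : ∀ P ∈ Φ, g P = 0 → P = 0)
    (hQ : (¬ LineUnramifiedAt W p Φ ∧ LineEven W p Φ) ∨ (LineUnramifiedAt W p Φ ∧ LineOdd W p Φ)) :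
    GVPar W' p := by
  refine ⟨Φ.map g, isRationalLine_map g hg hΦ hinj, ?_⟩
  rcases hQ with ⟨hr, he⟩ | ⟨hu, ho⟩
  · exact Or.inl ⟨not_lineUnramifiedAt_map g hg hinj hΦ hr, lineEven_map g hg he⟩
  · exact Or.inr ⟨lineUnramifiedAt_map g hg hu, lineOdd_map g hg ho⟩

end Transfer

/-! ### Ramification of a rational line does not depend on the prime above `p` -/

omit [W.IsElliptic] in
/-- A rational line moved by the inertia group of one prime of `\bar ℤ` above `p` is moved by the
inertia group of every prime above `p` (the primes above `p` are conjugate under `Γ_ℚ`,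
`I_{g𝔓} = g I_𝔓 g⁻¹`, and the line is `Γ_ℚ`-stable). [folklore] -/
theorem exists_inertia_smul_ne_of_not_lineUnramifiedAt {Φ : AddSubgroup (geomTorsion W (p : ℤ))}
    (hΦ : IsRationalLine W p Φ) (h : ¬ LineUnramifiedAt W p Φ)
    (v : HeightOneSpectrum (𝓞 ℚ)) (hv : (p : 𝓞 ℚ) ∈ v.asIdeal)
    (𝔓 : Ideal (absIntegers (𝓞 ℚ) ℚ)) (h𝔓 : 𝔓 ∈ v.primesAbove) :
    ∃ σ ∈ 𝔓.inertia (absoluteGaloisGroup ℚ), ∃ P ∈ Φ, σ • P ≠ P := by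
  have hp : p.Prime := Fact.out
  simp only [LineUnramifiedAt, not_forall, exists_prop] at h
  obtain ⟨v₀, hv₀, 𝔓₀, h𝔓₀, σ₀, hσ₀, P₀, hP₀, hne⟩ := h
  have hvv : v₀ = v := heightOneSpectrum_eq_of_natCast_mem hp hv₀ hv
  subst hvv
  obtain ⟨g₁, hg₁⟩ := HeightOneSpectrum.exists_smul_eq_of_mem_primesAbove_holds h𝔓₀ h𝔓
  refine ⟨g₁ * σ₀ * g₁⁻¹, ?_, g₁ • P₀, hΦ.2 g₁ P₀ hP₀, ?_⟩
  · rw [← hg₁]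
    exact (Ideal.conj_mem_inertia_smul_iff 𝔓₀ g₁ σ₀).mpr hσ₀
  · intro heq
    apply hne
    rw [mul_smul, mul_smul, inv_smul_smul] at heq
    exact MulAction.injective g₁ heq

end Literature.NumberTheory.EllipticCurves.Rank1Residual

end
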